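import Literature.AlgebraicGeometry.Resolution.LinearProjectionVertex
import Literature.AlgebraicGeometry.Resolution.Lemma411OffVertex
import Literature.AlgebraicGeometry.Resolution.AlterationsSectionDivisor
import Literature.AlgebraicGeometry.Motives.ToProjFunctionField
import Literature.AlgebraicGeometry.Resolution.AlterationsMultisectionProofs
import Literature.AlgebraicGeometry.Resolution.AlterationsDescentLimit
import Literature.Topology.KrullDimensionDrop
import HarnessLib

/-!
# The linear projection restricted to `Z` is generically étale: (ii) c) of Lemma 4.11

Topic: `Literature/AlgebraicGeometry/Resolution`. For the linear projection
`π = (t₀ : … : t_{d+1}) : X → ℙ^{d+1}_k` (`LinearProjection`) with `vertex ∉ π(Z)`, the sibling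
file `Lemma411OffVertex` reduces conclusion (ii) c) of de Jong's Lemma 4.11 ("`Z' ≅ Z → π(Z) →
ℙ^{d-1}` is generically étale by construction", de Jong 1996, p. 68) to the generic étaleness of
`pr ∘ π|_Z : Z_red → ℙ^d` (`DeJong1996.reducedProjection`). This file proves that generic
étaleness from a POINTWISE condition at one closed point on each irreducible component of `Z`
— the condition produced by the generic choice of the forms (`LinearSectionsJets`,
`JetsUnramified`):

* `DeJong1996.stalkMap_offVertexProjection_germ_sec` — **`(pr ∘ π)^*(yₐ/y_{i₀}) = tₐ/t_{i₀}` on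
  germs** (`GeneratingSections.app_sec` for the projection from the vertex and for `π`), and
  `stalkMap_offVertexProjection_algebraMap` (constants);
* `DeJong1996.exists_etale_nhd_reducedProjection` — **if at the point `z'` of `Z_red` over the
  closed point `z ∈ Z ∩ X_{t_{i₀}}` the ratios `tₐ/t_{i₀} - λₐ` generate `𝔪_z` modulo the stalk of
  the ideal of `Z`, and `dim 𝒪_{Z_red,z'} ≥ d`, then `pr ∘ π|_Z` is étale on a neighbourhood of
  `z'`** (`𝔪_y 𝒪_{Z,z'} = 𝔪_{z'}`; flat by Matsumura 23.1 over the regular `𝒪_{ℙ^d,y}`,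
  unramified with trivial residue extension; EGA IV₄ 17.6.1);
* `DeJong1996.isGenericallyEtale_reducedProjection_of_forall_component` — hence
  **`pr ∘ π|_Z` is generically étale** as soon as every irreducible component of `Z` contains such
  a point.

Everything is proved; no named facts.

## References

* A. J. de Jong, *Smoothness, semi-stability and alterations*, Publ. Math. IHÉS 83 (1996), 2.11
  and proof of Lemma 4.11, p. 68. [DeJong1996]
* H. Matsumura, *Commutative Ring Theory* (1986), Thm. 23.1. [Matsumura1987]
* A. Grothendieck, J. Dieudonné, *EGA IV₄*, Publ. Math. IHÉS 32 (1967), Thm. 17.6.1.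
  [Grothendieck1967]
-/

noncomputable section

open CategoryTheory CategoryTheory.Limits AlgebraicGeometry TopologicalSpace Opposite
  HomogeneousLocalization IsLocalRing
open Literature.AlgebraicGeometry.Morphisms.ProjCech (grading PP)
open Literature.AlgebraicGeometry.Motives
open Literature.AlgebraicGeometry.Motives.RatFn

attribute [local instance] MvPolynomial.gradedAlgebra
  Literature.AlgebraicGeometry.Motives.ProjBaseChange.algebraBase

namespace Literature.AlgebraicGeometry.Resolution

universe u

/-! ## `r^*(x_j/x_i)` is `r^*` of the coordinate section -/

namespace PlumbingZEtale

open Literature.AlgebraicGeometry.Motives.Segre (frac chartι toSpec pull pull_comp)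

variable {Y : Scheme.{u}} {n : ℕ} {K : Type u} [Field K] (r : Y ⟶ ProjSpace.P n K)

/-- The chart lift of `r` over `D₊(x_i)` is `r` restricted followed by the chart lift of the
identity. [folklore] -/
theorem chartLift_eq_morphismRestrict_comp (i : Fin (n + 1)) :
    GeneratingSections.chartLift r i =
      (r ∣_ ProjSpace.U i) ≫ GeneratingSections.chartLift (𝟙 (ProjSpace.P n K)) i := by
  refine (IsOpenImmersion.lift_uniq _ _ _ _ ?_).symm
  change ((r ∣_ ProjSpace.U i) ≫ GeneratingSections.chartLift (𝟙 (ProjSpace.P n K)) i) ≫ chartι K i =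
    (r ⁻¹ᵁ ProjSpace.U i).ι ≫ r
  rw [Category.assoc, GeneratingSections.chartLift_chartι, Category.comp_id, morphismRestrict_ι]

/-- **`r^*(x_j/x_i) = r^*(sec i (x_j/x_i))`**: the ratio section of `GeneratingSections.ofHom r`
is `r^*` of the coordinate section of `ℙⁿ`. [folklore] -/
theorem homRatio_eq_app_sec (i : Fin (n + 1)) (b : Away (grading K n) (MvPolynomial.X i)) :
    (GeneratingSections.preU r i).topIso.hom (pull (GeneratingSections.chartLift r i) b) =
      r.app (ProjSpace.U i) (ProjSpace.sec i b) := by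
  rw [ProjSpace.sec, Scheme.Hom.app_topIso_hom]
  have h1 : (r ∣_ ProjSpace.U i).appTop (pull (GeneratingSections.chartLift (𝟙 (ProjSpace.P n K)) i) b) =
      pull ((r ∣_ ProjSpace.U i) ≫ GeneratingSections.chartLift (𝟙 (ProjSpace.P n K)) i) b := by
    rw [pull_comp]; rfl
  rw [h1, ← chartLift_eq_morphismRestrict_comp]
  rfl

end PlumbingZEtale

namespace DeJong1996

open PlumbingZEtale
open Literature.AlgebraicGeometry.Motives.Segre (frac toSpec pull pull_comp)
open Scheme.IdealSheafData

variable {k : Type u} [Field k] (d : ℕ)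

/-! ## The projection from the vertex on germs of coordinate sections -/

/-- **`pr^*(yₐ/y_{i₀}) = x_{a}/x_{i₀}` on germs**, `pr` the projection from the vertex on the
punctured space `P = ℙ^{d+1} ∖ {vertex}` and `i₀, a ≤ d`: at `p ∈ P ∩ D₊(x_{i₀})`, the stalk map of
`pr` sends the germ of the coordinate section `yₐ/y_{i₀}` of `ℙ^d` to the image under the stalk
map of `P ↪ ℙ^{d+1}` of the germ of `x_a/x_{i₀}`. [folklore] -/
theorem stalkMap_vertexProjection_germ_sec (p : ↥(puncturedSpace d k)) (i₀ a : Fin (d + 1))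
    (hpV : vertexProjection d k p ∈ (ProjSpace.U i₀ : (ProjSpace.P d k).Opens))
    (hpP : (puncturedSpace d k).ι p ∈ (ProjSpace.U (Fin.castSucc i₀) : (ProjSpace.P (d + 1) k).Opens)) :
    ((vertexProjection d k).stalkMap p).hom
        (((ProjSpace.P d k).presheaf.germ (ProjSpace.U i₀) _ hpV).hom
          (ProjSpace.sec i₀ (frac k i₀ a))) =
      (((puncturedSpace d k).ι).stalkMap p).hom
        (((ProjSpace.P (d + 1) k).presheaf.germ (ProjSpace.U (Fin.castSucc i₀)) _ hpP).hom
          (ProjSpace.sec (Fin.castSucc i₀) (frac k (Fin.castSucc i₀) (Fin.castSucc a)))) := by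
  set G := puncturedSections d k with hG
  have hpU : p ∈ G.U i₀ := hpP
  -- left: `GeneratingSections.app_sec` for `pr = G.toProj _`
  rw [Scheme.Hom.germ_stalkMap_apply]
  change ((puncturedSpace d k : Scheme.{u}).presheaf.germ (G.toProj _ ⁻¹ᵁ ProjSpace.U i₀) p hpV).hom
      ((G.toProj _).app (ProjSpace.U i₀) (ProjSpace.sec i₀ (frac k i₀ a))) = _
  rw [GeneratingSections.app_sec, GeneratingSections.chartRingHom_frac,
    GeneratingSections.topIso_hom_res (le_of_eq (G.toProj_preimage_U _ i₀)),
    TopCat.Presheaf.germ_res_apply]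
  -- right: the ratio of `G = (ofHom P.ι).comapIndex castSucc` is `P.ι^*(sec (x_a/x_{i₀}))`
  rw [Scheme.Hom.germ_stalkMap_apply]
  change ((puncturedSpace d k : Scheme.{u}).presheaf.germ (G.U i₀) p hpU).hom
      ((GeneratingSections.preU (puncturedSpace d k).ι (Fin.castSucc i₀)).topIso.hom
        (pull (GeneratingSections.chartLift (puncturedSpace d k).ι (Fin.castSucc i₀))
          (frac k (Fin.castSucc i₀) (Fin.castSucc a)))) = _
  rw [homRatio_eq_app_sec]
  rfl

variable {X : Scheme.{u}} (π : X ⟶ ProjSpace.P (d + 1) k)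

/-- **`(pr ∘ π)^*(yₐ/y_{i₀})` on germs**: for `x° ∈ X° = π⁻¹(ℙ^{d+1} ∖ {vertex})` with
`π(x°) ∈ D₊(x_{i₀})`, the stalk map of `pr ∘ π : X° → ℙ^d` sends the germ of `yₐ/y_{i₀}` to the
image under `X° ↪ X` of `π^*` of the germ of `x_a/x_{i₀}`. [folklore] -/
theorem stalkMap_offVertexProjection_germ_sec (x : ↥(offVertex d k π)) (i₀ a : Fin (d + 1))
    (hyV : offVertexProjection d k π x ∈ (ProjSpace.U i₀ : (ProjSpace.P d k).Opens))
    (hxP : π ((offVertex d k π).ι x) ∈ (ProjSpace.U (Fin.castSucc i₀) : (ProjSpace.P (d + 1) k).Opens)) :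
    ((offVertexProjection d k π).stalkMap x).hom
        (((ProjSpace.P d k).presheaf.germ (ProjSpace.U i₀) _ hyV).hom
          (ProjSpace.sec i₀ (frac k i₀ a))) =
      (((offVertex d k π).ι).stalkMap x).hom ((π.stalkMap ((offVertex d k π).ι x)).hom
        (((ProjSpace.P (d + 1) k).presheaf.germ (ProjSpace.U (Fin.castSucc i₀)) _ hxP).hom
          (ProjSpace.sec (Fin.castSucc i₀) (frac k (Fin.castSucc i₀) (Fin.castSucc a))))) := by
  -- `pr ∘ π = (π|_P) ≫ pr` and `(π|_P) ≫ P.ι = X°.ι ≫ π`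
  set p := (π ∣_ puncturedSpace d k) x with hp
  have hpP : (puncturedSpace d k).ι p ∈
      (ProjSpace.U (Fin.castSucc i₀) : (ProjSpace.P (d + 1) k).Opens) := by
    rw [hp, ← Scheme.Hom.comp_apply, morphismRestrict_ι]
    exact hxP
  set γ' := ((ProjSpace.P (d + 1) k).presheaf.germ (ProjSpace.U (Fin.castSucc i₀)) _ hpP).hom
    (ProjSpace.sec (Fin.castSucc i₀) (frac k (Fin.castSucc i₀) (Fin.castSucc a))) with hγ'
  have step1 : ((offVertexProjection d k π).stalkMap x).hom
      (((ProjSpace.P d k).presheaf.germ (ProjSpace.U i₀) _ hyV).hom (ProjSpace.sec i₀ (frac k i₀ a))) =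
      ((π ∣_ puncturedSpace d k).stalkMap x).hom
        (((vertexProjection d k).stalkMap p).hom
          (((ProjSpace.P d k).presheaf.germ (ProjSpace.U i₀) _ (by exact hyV)).hom
            (ProjSpace.sec i₀ (frac k i₀ a)))) := by
    have hc := Scheme.Hom.stalkMap_comp (π ∣_ puncturedSpace d k) (vertexProjection d k) x
    exact congrArg (fun φ => φ.hom (((ProjSpace.P d k).presheaf.germ (ProjSpace.U i₀) _ hyV).hom
      (ProjSpace.sec i₀ (frac k i₀ a)))) hc
  have step2 := stalkMap_vertexProjection_germ_sec d p i₀ a (by exact hyV) hpP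
  have step3 : ((π ∣_ puncturedSpace d k).stalkMap x).hom
      ((((puncturedSpace d k).ι).stalkMap p).hom γ') =
        (((π ∣_ puncturedSpace d k) ≫ (puncturedSpace d k).ι).stalkMap x).hom γ' := by
    rw [Scheme.Hom.stalkMap_comp]; rfl
  -- both sides are the stalk map of `X°.ι ≫ π = (π|_P) ≫ P.ι` applied to the same germ
  have key : ∀ (F F' : (offVertex d k π : Scheme.{u}) ⟶ ProjSpace.P (d + 1) k) (_ : F = F')
      (hF : F x ∈ (ProjSpace.U (Fin.castSucc i₀) : (ProjSpace.P (d + 1) k).Opens))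
      (hF' : F' x ∈ (ProjSpace.U (Fin.castSucc i₀) : (ProjSpace.P (d + 1) k).Opens)),
      (F.stalkMap x).hom (((ProjSpace.P (d + 1) k).presheaf.germ _ _ hF).hom
        (ProjSpace.sec (Fin.castSucc i₀) (frac k (Fin.castSucc i₀) (Fin.castSucc a)))) =
      (F'.stalkMap x).hom (((ProjSpace.P (d + 1) k).presheaf.germ _ _ hF').hom
        (ProjSpace.sec (Fin.castSucc i₀) (frac k (Fin.castSucc i₀) (Fin.castSucc a)))) := by
    rintro F F' rfl hF hF'; rfl
  have step4 := key _ _ (morphismRestrict_ι π (puncturedSpace d k)) hpP (by exact hxP)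
  have step5 : (((offVertex d k π).ι ≫ π).stalkMap x).hom
      (((ProjSpace.P (d + 1) k).presheaf.germ _ _ (by exact hxP)).hom
        (ProjSpace.sec (Fin.castSucc i₀) (frac k (Fin.castSucc i₀) (Fin.castSucc a)))) =
      (((offVertex d k π).ι).stalkMap x).hom ((π.stalkMap ((offVertex d k π).ι x)).hom
        (((ProjSpace.P (d + 1) k).presheaf.germ (ProjSpace.U (Fin.castSucc i₀)) _ hxP).hom
          (ProjSpace.sec (Fin.castSucc i₀) (frac k (Fin.castSucc i₀) (Fin.castSucc a))))) := by
    rw [Scheme.Hom.stalkMap_comp]; rfl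
  rw [step1, step2, step3]
  exact step4.trans step5

/-- **Constants**: the stalk map of `pr ∘ π : X° → ℙ^d` followed back to `X` sends the structure
constants of `ℙ^d` to those of `X` — written with germs of global sections of the structure
morphisms (`π` being over `k`: `π ≫ (ℙ^{d+1} → Spec k) = fX`). [folklore] -/
theorem stalkMap_offVertexProjection_germ_const (fX : X ⟶ Spec (.of k))
    (hπ : π ≫ toSpec (Fin (d + 1 + 1)) k = fX) (x : ↥(offVertex d k π)) (c : k) :
    ((offVertexProjection d k π).stalkMap x).hom
        (((ProjSpace.P d k).presheaf.germ ⊤ _ trivial).hom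
          ((toSpec (Fin (d + 1)) k).appTop ((Scheme.ΓSpecIso (.of k)).inv c))) =
      (((offVertex d k π).ι).stalkMap x).hom
        ((X.presheaf.germ ⊤ _ trivial).hom (fX.appTop ((Scheme.ΓSpecIso (.of k)).inv c))) := by
  rw [Scheme.Hom.germ_stalkMap_apply, Scheme.Hom.germ_stalkMap_apply]
  change ((offVertex d k π : Scheme.{u}).presheaf.germ ⊤ x trivial).hom
      ((offVertexProjection d k π).appTop ((toSpec (Fin (d + 1)) k).appTop _)) =
    ((offVertex d k π : Scheme.{u}).presheaf.germ ⊤ x trivial).hom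
      (((offVertex d k π).ι).appTop (fX.appTop _))
  congr 1
  have h1 : ∀ s, (offVertexProjection d k π).appTop ((toSpec (Fin (d + 1)) k).appTop s) =
      (offVertexProjection d k π ≫ toSpec (Fin (d + 1)) k).appTop s := fun s => by
    rw [Scheme.Hom.comp_appTop]; rfl
  have h2 : ∀ s, ((offVertex d k π).ι).appTop (fX.appTop s) = ((offVertex d k π).ι ≫ fX).appTop s :=
    fun s => by rw [Scheme.Hom.comp_appTop]; rfl
  rw [h1, h2, offVertexProjection_toSpec, hπ]

/-! ## Surjective local homomorphisms map `𝔪` onto `𝔪` -/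

/-- A surjective local homomorphism of local rings maps the maximal ideal ONTO the maximal
ideal. [folklore] -/
theorem _root_.Literature.AlgebraicGeometry.Resolution.PlumbingZEtale.map_maximalIdeal_of_surjective
    {R S : Type*} [CommRing R] [CommRing S] [IsLocalRing R] [IsLocalRing S] (σ : R →+* S)
    [IsLocalHom σ] (hσ : Function.Surjective σ) : (maximalIdeal R).map σ = maximalIdeal S := by
  apply le_antisymm
  · refine Ideal.map_le_iff_le_comap.mpr fun x hx => ?_
    rw [Ideal.mem_comap, mem_maximalIdeal, mem_nonunits_iff]
    exact fun hu => (mem_maximalIdeal _).mp hx (isUnit_of_map_unit σ x hu)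
  · intro s hs
    obtain ⟨r, rfl⟩ := hσ s
    refine Ideal.mem_map_of_mem _ ((mem_maximalIdeal _).mpr fun hr => ?_)
    exact (mem_maximalIdeal _).mp hs (hr.map σ)

/-! ## Étale at a point of `Z_red` where the ratios generate `𝔪` modulo the ideal of `Z` -/

section Pointwise

variable [IsAlgClosed k] {X : Scheme.{u}} (π : X ⟶ ProjSpace.P (d + 1) k)
  {Z : Set X} (hZ : IsClosed Z) (hπZ : vertex d k ∉ π '' Z)
  (fX : X ⟶ Spec (.of k)) (hπ : π ≫ toSpec (Fin (d + 1 + 1)) k = fX)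

/-- The structure constant `c ∈ 𝒪_{X,x}` of the `k`-scheme `fX : X → Spec k` (the germ of the
global function `c`). [folklore] -/
abbrev constGerm (x : X) (c : k) : X.presheaf.stalk x :=
  (X.presheaf.germ ⊤ x trivial).hom (fX.appTop ((Scheme.ΓSpecIso (.of k)).inv c))

/-- **The ratio germs `π^*(xₐ/x_{i₀})_x ∈ 𝒪_{X,x}`**, `a ≤ d`, at a point `x` with
`π(x) ∈ D₊(x_{i₀})`. [folklore] -/
abbrev ratioGerm {x : X} {i₀ : Fin (d + 1)}
    (hxP : π x ∈ (ProjSpace.U (Fin.castSucc i₀) : (ProjSpace.P (d + 1) k).Opens)) (a : Fin (d + 1)) :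
    X.presheaf.stalk x :=
  (π.stalkMap x).hom (((ProjSpace.P (d + 1) k).presheaf.germ (ProjSpace.U (Fin.castSucc i₀)) _ hxP).hom
    (ProjSpace.sec (Fin.castSucc i₀) (frac k (Fin.castSucc i₀) (Fin.castSucc a))))

/-- `Z_red`. -/
local notation "ZR" => Scheme.IdealSheafData.subscheme (vanishingIdeal (Closeds.mk Z hZ : Closeds X))
/-- `r : Z_red → X°`. -/
local notation "rZ" => reducedToOffVertex d k π hZ hπZ
/-- `X° ↪ X`. -/
local notation "ιX" => Scheme.Opens.ι (offVertex d k π)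

include hπ in
set_option maxHeartbeats 800000 in
/-- **`pr ∘ π|_Z : Z_red → ℙ^d` is étale near a point where the ratios generate the maximal ideal
modulo the ideal of `Z`.** Let `z'` be a point of the reduced closed subscheme `Z_red` whose image
`z ∈ X` is a closed point with `π(z) ∈ D₊(x_{i₀})`, `i₀ ≤ d`. Suppose that for some `λ ∈ k^{d+1}`
the germs `π^*(xₐ/x_{i₀})_z - λₐ`, `a ≤ d`, generate `𝔪_z` together with the stalk `I_z` of the
ideal of `Z`, and that `dim 𝒪_{Z_red, z'} ≥ d`. Then `pr ∘ π|_Z` is étale on an open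
neighbourhood of `z'`: `𝔪_y 𝒪_{Z_red,z'} = 𝔪_{z'}` for `y` the image of `z'`, so the stalk map is
unramified (`κ = k`) and flat over the regular `𝒪_{ℙ^d, y}` of dimension `d` (Matsumura 23.1),
whence étale near `z'` (EGA IV₄ 17.6.1). [cite: DeJong1996, Lemma 4.11 (proof), p. 68]
[cite: Matsumura1987, Thm. 23.1] [cite: Grothendieck1967, Thm. 17.6.1] -/
theorem exists_etale_nhd_reducedProjection [IsAffineHom π] [IsProper fX]
    (z' : ↥((vanishingIdeal ⟨Z, hZ⟩ : Scheme.IdealSheafData X).subscheme)) {z : X}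
    (hz : (offVertex d k π).ι (reducedToOffVertex d k π hZ hπZ z') = z)
    (hzc : IsClosed ({z} : Set X)) {i₀ : Fin (d + 1)}
    (hxP : π z ∈ (ProjSpace.U (Fin.castSucc i₀) : (ProjSpace.P (d + 1) k).Opens))
    (lam : Fin (d + 1) → k)
    (hJ : Ideal.span (Set.range fun a => ratioGerm d π hxP a - constGerm fX z (lam a)) ⊔
        stalkIdeal (vanishingIdeal ⟨Z, hZ⟩) z = maximalIdeal (X.presheaf.stalk z))
    (hdim : (d : WithBot ℕ∞) ≤
      ringKrullDim (((vanishingIdeal ⟨Z, hZ⟩ : Scheme.IdealSheafData X).subscheme).presheaf.stalk z')) :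
    ∃ O : ((vanishingIdeal ⟨Z, hZ⟩ : Scheme.IdealSheafData X).subscheme).Opens,
      z' ∈ O ∧ Etale (O.ι ≫ reducedProjection d k π hZ hπZ) := by
  subst hz
  haveI : IsProper (toSpec (Fin (d + 1)) k) := ProjSpace.isProper_over d k
  haveI : IsProper (π ≫ toSpec (Fin (d + 1 + 1)) k) := by rw [hπ]; infer_instance
  haveI : IsFinite (reducedProjection d k π hZ hπZ) := isFinite_reducedProjection d k π hZ hπZ
  haveI : IsLocallyNoetherian X := LocallyOfFiniteType.isLocallyNoetherian fX
  haveI : IsLocallyNoetherian ZR :=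
    LocallyOfFiniteType.isLocallyNoetherian ((vanishingIdeal ⟨Z, hZ⟩).subschemeι ≫ fX)
  haveI : IsLocallyNoetherian (ProjSpace.P d k) :=
    LocallyOfFiniteType.isLocallyNoetherian (toSpec (Fin (d + 1)) k)
  haveI : LocallyOfFinitePresentation (reducedProjection d k π hZ hπZ) :=
    Descent45.Setup.locallyOfFinitePresentation_of_isLocallyNoetherian _
  -- `y = pr (π z) ∈ D₊(y_{i₀})`
  have hGr : reducedProjection d k π hZ hπZ z' = offVertexProjection d k π (rZ z') := rfl
  have hyV : offVertexProjection d k π (rZ z') ∈ (ProjSpace.U i₀ : (ProjSpace.P d k).Opens) := by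
    change vertexProjection d k ((π ∣_ puncturedSpace d k) (rZ z')) ∈
      Proj.basicOpen (grading k d) (MvPolynomial.X i₀)
    rw [← Scheme.Hom.mem_preimage, vertexProjection_preimage_basicOpen, Scheme.Hom.mem_preimage,
      ← Scheme.Hom.comp_apply, morphismRestrict_ι]
    exact hxP
  -- the stalk maps: `ψ = ρ' ∘ (pr ∘ π)^*`, `σ = ρ' ∘ e` (`e : 𝒪_{X,z} ≅ 𝒪_{X°,x}`)
  set ψ : (ProjSpace.P d k).presheaf.stalk (offVertexProjection d k π (rZ z')) →+* (ZR).presheaf.stalk z' :=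
    ((reducedProjection d k π hZ hπZ).stalkMap z').hom with hψ
  set ρ' := ((rZ).stalkMap z').hom with hρ'
  set e := ((ιX).stalkMap (rZ z')).hom with he
  haveI hci : IsClosedImmersion (rZ ≫ ιX) := by
    rw [reducedToOffVertex_ι]; infer_instance
  set σ : X.presheaf.stalk (ιX (rZ z')) →+* (ZR).presheaf.stalk z' := ((rZ ≫ ιX).stalkMap z').hom
    with hσ
  have hσe : σ = ρ'.comp e := by
    rw [hσ, Scheme.Hom.stalkMap_comp]; rfl
  have hψ' : ψ = ρ'.comp ((offVertexProjection d k π).stalkMap (rZ z')).hom := by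
    rw [hψ]
    change ((rZ ≫ offVertexProjection d k π).stalkMap z').hom = _
    rw [Scheme.Hom.stalkMap_comp]; rfl
  -- `σ` is surjective and local with kernel `I_z`
  have hσsurj : Function.Surjective σ := (rZ ≫ ιX).stalkMap_surjective z'
  haveI : IsLocalHom σ := inferInstanceAs (IsLocalHom ((rZ ≫ ιX).stalkMap z').hom)
  have hk : (rZ ≫ ιX).ker = vanishingIdeal ⟨Z, hZ⟩ := by
    rw [reducedToOffVertex_ι, ker_subschemeι]
  have hkerσ : RingHom.ker σ = stalkIdeal (vanishingIdeal ⟨Z, hZ⟩) (ιX (rZ z')) := by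
    have h := stalkIdeal_ker_eq_ker_stalkMap (rZ ≫ ιX) z'
    rw [hk] at h
    exact h.symm
  -- generators of `𝔪_y` mapping to `e (ratio - λ)`
  have hgen : ∀ a : Fin (d + 1),
      ∃ γ ∈ maximalIdeal ((ProjSpace.P d k).presheaf.stalk (offVertexProjection d k π (rZ z'))),
      ((offVertexProjection d k π).stalkMap (rZ z')).hom γ =
        e (ratioGerm d π hxP a - constGerm fX (ιX (rZ z')) (lam a)) := by
    intro a
    refine ⟨((ProjSpace.P d k).presheaf.germ (ProjSpace.U i₀) _ hyV).hom (ProjSpace.sec i₀ (frac k i₀ a)) -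
      ((ProjSpace.P d k).presheaf.germ ⊤ _ trivial).hom
        ((toSpec (Fin (d + 1)) k).appTop ((Scheme.ΓSpecIso (.of k)).inv (lam a))), ?_, ?_⟩
    swap
    · rw [map_sub, map_sub, stalkMap_offVertexProjection_germ_sec d π (rZ z') i₀ a hyV hxP,
        stalkMap_offVertexProjection_germ_const d π fX hπ (rZ z') (lam a)]
    · -- non-unit since its image `σ (ratio - λ)` lies in `𝔪_{z'}`
      rw [mem_maximalIdeal, mem_nonunits_iff]
      intro hu
      have h1 := hu.map ψ
      rw [hψ', RingHom.comp_apply, map_sub, stalkMap_offVertexProjection_germ_sec d π (rZ z') i₀ a hyV hxP,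
        stalkMap_offVertexProjection_germ_const d π fX hπ (rZ z') (lam a), ← map_sub, ← RingHom.comp_apply,
        ← hσe] at h1
      have hmem : ratioGerm d π hxP a - constGerm fX (ιX (rZ z')) (lam a) ∈
          maximalIdeal (X.presheaf.stalk (ιX (rZ z'))) := by
        rw [← hJ]
        exact Ideal.mem_sup_left (Ideal.subset_span ⟨a, rfl⟩)
      exact (mem_maximalIdeal _).mp hmem (isUnit_of_map_unit σ _ h1)
  -- `𝔪_y 𝒪_{Z,z'} = 𝔪_{z'}`
  haveI : IsLocalHom ψ := inferInstanceAs (IsLocalHom ((reducedProjection d k π hZ hπZ).stalkMap z').hom)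
  have hmap : (maximalIdeal ((ProjSpace.P d k).presheaf.stalk (offVertexProjection d k π (rZ z')))).map ψ =
      maximalIdeal ((ZR).presheaf.stalk z') := by
    apply le_antisymm
    · refine Ideal.map_le_iff_le_comap.mpr fun γ hγ => ?_
      rw [Ideal.mem_comap, mem_maximalIdeal, mem_nonunits_iff]
      exact fun hu => (mem_maximalIdeal _).mp hγ (isUnit_of_map_unit ψ γ hu)
    · -- `𝔪_{z'} = σ(𝔪_z) = σ(span ⊔ I_z) ≤ 𝔪_y.map ψ`
      have h1 : maximalIdeal ((ZR).presheaf.stalk z') = (maximalIdeal (X.presheaf.stalk (ιX (rZ z')))).map σ :=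
        (PlumbingZEtale.map_maximalIdeal_of_surjective σ hσsurj).symm
      rw [h1, ← hJ, Ideal.map_sup, (Ideal.map_eq_bot_iff_le_ker σ).mpr hkerσ.ge, sup_bot_eq,
        Ideal.map_span]
      refine Ideal.span_le.mpr ?_
      rintro _ ⟨_, ⟨a, rfl⟩, rfl⟩
      obtain ⟨γ, hγ, hγe⟩ := hgen a
      have : σ (ratioGerm d π hxP a - constGerm fX (ιX (rZ z')) (lam a)) = ψ γ := by
        rw [hσe, RingHom.comp_apply, ← hγe, hψ', RingHom.comp_apply]
      rw [this]
      exact Ideal.mem_map_of_mem _ hγ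
  -- the fibre ring is the residue field
  have hF : IsField ((ZR).presheaf.stalk z' ⧸
      (maximalIdeal ((ProjSpace.P d k).presheaf.stalk (reducedProjection d k π hZ hπZ z'))).map
        ((reducedProjection d k π hZ hπZ).stalkMap z').hom) := by
    change IsField (_ ⧸ (maximalIdeal ((ProjSpace.P d k).presheaf.stalk
      (offVertexProjection d k π (rZ z')))).map ψ)
    rw [hmap]
    exact (Ideal.Quotient.maximal_ideal_iff_isField_quotient _).mp inferInstance
  -- closed points: `z'` and `y`
  have hz'c : IsClosed ({z'} : Set ZR) := by
    rw [(rZ ≫ ιX).isClosedEmbedding.isClosed_iff_image_isClosed, Set.image_singleton]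
    exact hzc
  have hyc : IsClosed ({reducedProjection d k π hZ hπZ z'} : Set (ProjSpace.P d k)) := by
    have := (reducedProjection d k π hZ hπZ).isClosedMap _ hz'c
    rwa [Set.image_singleton] at this
  -- unramified
  haveI : IsAlgClosed ((ProjSpace.P d k).residueField (reducedProjection d k π hZ hπZ z')) :=
    isAlgClosed_residueField_of_isClosed (toSpec (Fin (d + 1)) k) hyc
  have hur : ((reducedProjection d k π hZ hπZ).stalkMap z').hom.FormallyUnramified := by
    refine formallyUnramified_stalkMap_of_isField (reducedProjection d k π hZ hπZ) z' hF ?_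
    letI : Algebra ((ProjSpace.P d k).residueField (reducedProjection d k π hZ hπZ z'))
        ((ZR).residueField z') := ((reducedProjection d k π hZ hπZ).residueFieldMap z').hom.toAlgebra
    haveI : Module.Finite ((ProjSpace.P d k).residueField (reducedProjection d k π hZ hπZ z'))
        ((ZR).residueField z') :=
      Scheme.Hom.finite_residueField_of_isFinite (reducedProjection d k π hZ hπZ) z'
    exact Algebra.IsAlgebraic.isSeparable_of_perfectField
  -- flat by Matsumura 23.1
  have hfl : ((reducedProjection d k π hZ hπZ).stalkMap z').hom.Flat := by
    letI := ((reducedProjection d k π hZ hπZ).stalkMap z').hom.toAlgebra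
    haveI : IsLocalHom (algebraMap ((ProjSpace.P d k).presheaf.stalk (reducedProjection d k π hZ hπZ z'))
        ((ZR).presheaf.stalk z')) :=
      inferInstanceAs (IsLocalHom ((reducedProjection d k π hZ hπZ).stalkMap z').hom)
    haveI : IsRegularLocalRing ((ProjSpace.P d k).presheaf.stalk (reducedProjection d k π hZ hπZ z')) :=
      isRegular_projectiveSpace (n := d) (k := k) _
    have hF' : IsRegularLocalRing ((ZR).presheaf.stalk z' ⧸
        (maximalIdeal ((ProjSpace.P d k).presheaf.stalk (reducedProjection d k π hZ hπZ z'))).map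
          (algebraMap ((ProjSpace.P d k).presheaf.stalk (reducedProjection d k π hZ hπZ z'))
            ((ZR).presheaf.stalk z'))) := by
      letI := hF.toField
      infer_instance
    have h0 : ringKrullDim ((ZR).presheaf.stalk z' ⧸
        (maximalIdeal ((ProjSpace.P d k).presheaf.stalk (reducedProjection d k π hZ hπZ z'))).map
          (algebraMap ((ProjSpace.P d k).presheaf.stalk (reducedProjection d k π hZ hπZ z'))
            ((ZR).presheaf.stalk z'))) = 0 :=
      ringKrullDim_eq_zero_of_isField hF
    have hdimA : ringKrullDim ((ProjSpace.P d k).presheaf.stalk (reducedProjection d k π hZ hπZ z')) = d := by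
      rw [ringKrullDim_stalk_eq_of_isClosed (toSpec (Fin (d + 1)) k) hyc, ProjSpace.topologicalKrullDim_eq]
    have hle : ringKrullDim ((ProjSpace.P d k).presheaf.stalk (reducedProjection d k π hZ hπZ z')) +
        ringKrullDim ((ZR).presheaf.stalk z' ⧸
          (maximalIdeal ((ProjSpace.P d k).presheaf.stalk (reducedProjection d k π hZ hπZ z'))).map
            (algebraMap ((ProjSpace.P d k).presheaf.stalk (reducedProjection d k π hZ hπZ z'))
              ((ZR).presheaf.stalk z'))) ≤
        ringKrullDim ((ZR).presheaf.stalk z') := by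
      rw [h0, add_zero, hdimA]
      exact hdim
    exact Literature.RingTheory.Flat.flat_of_isRegularLocalRing_of_isRegularLocalRing_fiber hF' hle
  -- étale near `z'`
  exact exists_etale_ι_comp_of_flat_of_formallyUnramified_stalkMap _ z' hfl hur

end Pointwise

/-! ## Generic étaleness from one étale neighbourhood per irreducible component -/

section Density

variable {X S : Scheme.{u}} {Z : Set X} (hZ : IsClosed Z)

/-- **Étale near a point over each component generic point ⇒ generically étale.** Let `Z ⊆ X`
be closed and `G : Z_red → S`. If for every generic point `w` of an irreducible component of `Z`
there is a point `z'` of `Z_red` to which `w` specialises (in `X`) such that `G` is étale on a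
neighbourhood of `z'`, then `G` is generically étale (2.6): an open neighbourhood of `z'`
contains the generisation `w`, so the union of these neighbourhoods contains every component
generic point of `Z_red ≅ Z` and is dense. [cite: DeJong1996, 2.6, p. 55] -/
theorem isGenericallyEtale_subscheme_of_forall_genericPoints [QuasiSober X]
    (G : ((vanishingIdeal ⟨Z, hZ⟩ : Scheme.IdealSheafData X).subscheme : Scheme.{u}) ⟶ S)
    (h : ∀ w ∈ Subtype.val '' genericPoints ↥Z,
      ∃ z' : (vanishingIdeal ⟨Z, hZ⟩ : Scheme.IdealSheafData X).subscheme,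
        w ⤳ (vanishingIdeal ⟨Z, hZ⟩ : Scheme.IdealSheafData X).subschemeι z' ∧
        ∃ O : ((vanishingIdeal ⟨Z, hZ⟩ : Scheme.IdealSheafData X).subscheme).Opens,
          z' ∈ O ∧ Etale (O.ι ≫ G)) :
    IsGenericallyEtale G := by
  choose z' hwz' O hz'O hO using h
  refine IsGenericallyEtale.of_iSup (fun w : ↥(Subtype.val '' genericPoints ↥Z) => O w.1 w.2)
    (fun w => hO w.1 w.2) ?_
  rw [dense_iff_inter_open]
  rintro W hW ⟨z₀, hz₀⟩
  -- `ι z₀ ∈ Z` is a specialisation of a component generic point `w = ι w'`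
  have hx : (vanishingIdeal ⟨Z, hZ⟩ : Scheme.IdealSheafData X).subschemeι z₀ ∈ Z :=
    mem_of_subscheme_vanishingIdeal ⟨Z, hZ⟩ z₀
  haveI : QuasiSober ↥Z := Literature.Topology.quasiSober_of_isClosed hZ
  let C : irreducibleComponents ↥Z :=
    ⟨irreducibleComponent (⟨_, hx⟩ : ↥Z), irreducibleComponent_mem_irreducibleComponents _⟩
  let η := genericPoints.ofComponent C
  have hηx : η.1 ⤳ (⟨_, hx⟩ : ↥Z) :=
    (genericPoints.isGenericPoint_ofComponent C).specializes mem_irreducibleComponent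
  have hw : (η.1 : X) ∈ Subtype.val '' genericPoints ↥Z := ⟨η.1, η.2, rfl⟩
  have hwx : (η.1 : X) ⤳ (vanishingIdeal ⟨Z, hZ⟩ : Scheme.IdealSheafData X).subschemeι z₀ :=
    hηx.map continuous_subtype_val
  obtain ⟨w', hw'⟩ : (η.1 : X) ∈
      Set.range (vanishingIdeal ⟨Z, hZ⟩ : Scheme.IdealSheafData X).subschemeι := by
    rw [range_subschemeι_vanishingIdeal]; exact η.1.2
  have hind := (vanishingIdeal ⟨Z, hZ⟩ : Scheme.IdealSheafData X).subschemeι.isClosedEmbedding.isInducing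
  have h1 : w' ⤳ z₀ := hind.specializes_iff.mp (by rw [hw']; exact hwx)
  have h2 : w' ⤳ z' _ hw := hind.specializes_iff.mp (by rw [hw']; exact hwz' _ hw)
  exact ⟨w', h1.mem_open hW hz₀,
    Opens.mem_iSup.mpr ⟨⟨_, hw⟩, h2.mem_open (O _ hw).isOpen (hz'O _ hw)⟩⟩

end Density

/-! ## (ii) c) for the linear projection: `pr ∘ π|_Z` is generically étale -/

section Conclusion

variable [IsAlgClosed k] {X : Scheme.{u}} (π : X ⟶ ProjSpace.P (d + 1) k)
  {Z : Set X} (hZ : IsClosed Z) (hπZ : vertex d k ∉ π '' Z)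
  (fX : X ⟶ Spec (.of k)) (hπ : π ≫ toSpec (Fin (d + 1 + 1)) k = fX)

include hπ in
/-- **`pr ∘ π|_Z : Z_red → ℙ^d` is generically étale** as soon as every irreducible component of
`Z` (given by its generic point `w`) contains a closed point `z ∈ X_{t_{i₀}}` at which, for some
`λ`, the germs `π^*(xₐ/x_{i₀}) - λₐ` (`a ≤ d`) generate `𝔪_z` modulo the ideal of `Z` and
`dim 𝒪_{Z_red,z} ≥ d` — the situation achieved by a generic choice of the linear forms defining
`π` (de Jong: "`Z → π(Z) → ℙ^{d-1}` is generically étale by construction").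
[cite: DeJong1996, Lemma 4.11 (proof), p. 68] [cite: Matsumura1987, Thm. 23.1] -/
theorem isGenericallyEtale_reducedProjection [IsAffineHom π] [IsProper fX]
    (h : ∀ w ∈ Subtype.val '' genericPoints ↥Z, ∃ z ∈ Z, w ⤳ z ∧ IsClosed ({z} : Set X) ∧
      ∃ (i₀ : Fin (d + 1)) (hxP : π z ∈ (ProjSpace.U (Fin.castSucc i₀) : (ProjSpace.P (d + 1) k).Opens))
        (lam : Fin (d + 1) → k),
        Ideal.span (Set.range fun a => ratioGerm d π hxP a - constGerm fX z (lam a)) ⊔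
            stalkIdeal (vanishingIdeal ⟨Z, hZ⟩) z = maximalIdeal (X.presheaf.stalk z) ∧
        ∀ z' : (vanishingIdeal ⟨Z, hZ⟩ : Scheme.IdealSheafData X).subscheme,
          (vanishingIdeal ⟨Z, hZ⟩ : Scheme.IdealSheafData X).subschemeι z' = z →
            (d : WithBot ℕ∞) ≤ ringKrullDim
              (((vanishingIdeal ⟨Z, hZ⟩ : Scheme.IdealSheafData X).subscheme).presheaf.stalk z')) :
    IsGenericallyEtale (reducedProjection d k π hZ hπZ) := by
  refine isGenericallyEtale_subscheme_of_forall_genericPoints hZ _ fun w hw => ?_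
  obtain ⟨z, hzZ, hwz, hzc, i₀, hxP, lam, hJ, hdim⟩ := h w hw
  obtain ⟨z', hz'⟩ : z ∈ Set.range (vanishingIdeal ⟨Z, hZ⟩ : Scheme.IdealSheafData X).subschemeι := by
    rw [range_subschemeι_vanishingIdeal]; exact hzZ
  have hz : (offVertex d k π).ι (reducedToOffVertex d k π hZ hπZ z') = z := by
    rw [← Scheme.Hom.comp_apply, reducedToOffVertex_ι]; exact hz'
  obtain ⟨O, hO, hOe⟩ := exists_etale_nhd_reducedProjection d π hZ hπZ fX hπ z' hz hzc hxP lam hJ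
    (hdim z' hz')
  exact ⟨z', by rw [hz']; exact hwz, O, hO, hOe⟩

end Conclusion

end DeJong1996

end Literature.AlgebraicGeometry.Resolution

end
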